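import Summits.Parity.BatemanHorn.Theses.IsogenyRedei

/-!
# Disproof of `SplitBlockJacobi` (stmt-Parity-11583) — standing adversary file

Crux (route IsogenyRedei, rank 2):
`∀ θ ∈ (1/2, 1), J_θ(x) := Σ_{t ≤ x} Σ_{(Q,Q') ∈ pf(t²+1)², x^θ < Q < Q'} (Q|Q') = o(x)`.

## Findings (index; details in the docstrings below)

* §0  `J`, `pairs` : the crux's function, `splitBlockJacobi_iff : SplitBlockJacobi ↔ ∀ θ, … J θ =o x`
  (`Iff.rfl`).
* §A  LOAD-BEARING ANALYSIS of the two hypotheses.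
  - `θ < 1` is NOT load-bearing: for `θ ≥ 1` every pair set is empty (`pairs_eq_empty_of_one_le`),
    so `J θ = 0` and `SplitBlockJacobi ↔ SplitBlockJacobiWithoutUpper` (upper bound dropped).
  - `1/2 < θ` : dropping it ENTIRELY is false (numerically, this seat): at `θ = 0` all prime pairs count and
    `J_0(x)/x = −0.4292, −0.4318, −0.4306, −0.4317, −0.4292, −0.4290, −0.4310` at `x = 2.5·10⁴, 5·10⁴, 10⁵, 2·10⁵,
    5·10⁵, 10⁶, 10⁷` (theta0 tables and kit j004903 TABLE A on the item), matching the predicted `J_0(x) ~ c₀·x`, `c₀ = Σ_{Q<Q'} (Q|Q') ρ(Q)ρ(Q')/(QQ')` (ρ(2)=1, ρ(p)=2):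
    partial sums `c₀(10²) = −0.369, c₀(10³) = −0.418, c₀(10⁴) = −0.427, c₀(10⁵) = −0.4300, c₀(3·10⁵) = −0.4305`
    (kit j004900). See `not_SplitBlockJacobiWithoutLower`
    (near-miss, `sorry`: an effective version is not cheaply formalisable).
    For `0 < θ ≤ 1/2` the statement is heuristically TRUE but carries a deterministic SECULAR TERM
    `J_θ(x) ≈ c_θ(x)·x^{1−θ} + O(√x)` (tail of the same pair series: measured `J_θ/x = −0.143, −0.046, −0.005`
    at `θ = 0.1, 0.2, 0.3`, `x = 10⁶`, i.e. `J_θ/√N_θ = −84, −35, −5.0`, GROWING in `x` like `x^{1/2−θ}` (−41, −13,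
    −6.5 at 2·10⁵; at 10⁷ (kit j004903): `J/√N = −54, −15.6, −6.2, −2.7, −0.6, −0.4` at `θ = .2, .3, .4, .45, .5, .51`
    and `+0.4, +1.0, +2.4, +2.4, +1.9, +1.7, +2.6, +1.7, +1.5` at `θ = .55, .6, …, .95` — the SIGN FLIPS AT θ = 1/2),
    while `|J_θ|/√N_θ ≤ 2.7` for every `θ ≥ 1/2` up to 10⁷ with the familiar POSITIVE sign): so the
    natural strengthening "`J_θ(x) = O(x^{1/2+ε})` for all `θ ∈ (0,1)`" is FALSE below `θ = 1/2`, and `θ = 1/2`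
    is exactly the crossover where the secular term `x^{1−θ}` sinks under the `√x` noise — the analytic face of
    the combinatorial "≤ 3 pairs per t". The honest load-bearing content of `1/2 < θ`: it removes the secular term.
* §B  ARITHMETIC OF THE PAIRS: every `Q ∈ pf(t²+1)` with `Q ≠ 2` is `≡ 1 (mod 4)`
  (`mod_four_eq_one_of_mem_primeFactors`), hence `(Q|Q') = (Q'|Q)` on every pair of the sum
  (`jacobiSym_symm_of_mem_pairs`): the summand is ONE well-defined sign per value, as the card says.
  Divisibility alone imposes no constraint on the sign: both signs occur (`sign_neg_example`,
  `sign_pos_example`), and for ANY two primes `Q ≠ Q'`, `Q ≡ Q' ≡ 1 (4)`, some `t` has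
  `QQ' ∣ t²+1` (`exists_t_of_primes`) — the only coupling between `(Q|Q')` and `t` is the SIZE
  condition `t ≤ x` (a small root of −1 mod QQ'), cf. refuter g44-25 / rattack dossiers on the item.
  Range/Fubini lemmas: `mul_le_of_mem_pairs` (`QQ' ≤ x²+1`, `Q ≤ x`), `lt_mul_of_mem_pairs` (`x < QQ'`: every
  modulus is beyond `x`), `J_eq_sum_pairs_mul_card` (modulus-side form `J = Σ_pairs (Q|Q')·#{t}`).
* §C  TIGHTNESS (trivial bound, proved): for `x ≥ x₀(θ) = ⌈2^{1/(4θ−2)}⌉` at most THREE primes `> x^θ`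
  divide `t²+1` (`card_bigFactors_le_three`), so `|J_θ(x)| ≤ 9x` (`abs_J_le`) and `J_θ = O(x)` (`isBigO_J`):
  the crux is exactly the `o(x)`-versus-`O(x)` gap — pure sign cancellation among ≍_θ x symbols.
* §D  SIGN-COHERENT ALGEBRAIC FAMILIES (proved): along the Aurifeuillian family `t = 2m²`,
  `t²+1 = (2m²−2m+1)(2m²+2m+1)`, the FULL SIGN LAW `jacobiSym_aur`: symbol `= −1` iff `m ≡ 2 (mod 4)` (cases
  `jacobiSym_aur_of_odd`, `_of_two_mod_four`, `_of_four_dvd`): the natural strengthening "the signs equidistribute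
  along every infinite algebraic family of factorisations" is FALSE; cancellation can only come from sparsity
  of/across families (this family alone is far too thin to explain the +√N offsets; see §D′/§D″/§H).
* §D′ DIFFERENCE-SQUARE FAMILY (proved): `(Q + 4s² | Q) = 1` (`jacobiSym_add_four_mul_sq`), so every pair with
  `Q' − Q = 4s²` contributes `+1` (`jacobiSym_eq_one_of_sq_diff`): the source of the POSITIVE secular term (balanced
  pairs), opposite to the Chebyshev term of §H (unbalanced pairs); both measured region by region by crux-triage r1-2.
* §D″ DESCENT PARAMETRISATION (identities proved, law verified): `(t−A)²+1 = A(A+B−2t)`; families F_k by `k = (A+B)/2−t`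
  (F_1 = Aurifeuillian); `(B|A) = (B−A|A) = (2|A)^{1+v₂(w)}(2k(k²+1)|w_odd)` periodic per family, identically coherent only
  for k = 1; many members ⟺ small k ⟺ balanced pairs; crux pairs have 2k ≈ Q' (one member: the small-root regime again).
* §F  STRUCTURE (proved): in SL₂(ℤ)-coordinates `t²+1 = (a²+b²)(c²+d²)`, `t = ac+bd`, the symbol is the
  SPIN `(a²+b² | c²+d²) = (1 + 2bc | c²+d²)` (`jacobiSym_rows_eq_spin`), periodic with period `B = c²+d²`
  along horocycles (`jacobiSym_rows_horocycle`) and not a congruence character (`spin_gammaM_values`):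
  complete/Burgess averaging exists exactly while `B ≤ x^{1−ε}`; for `B > x` one point per horocycle.
* §G  FUNCTION-FIELD MODEL (prose + data, kit j005729): exact identities at n = 2 (S = −q) and n = 3; structured
  square-root-size fluctuations S = O_q(√(q^n)) (|S|/√N up to 15 at q = 19, signs alternating in n), empirical law
  |S/N| ≈ c·q^{−(n−2)/2} → 0 (q = 3 to n = 14, q = 7 to n = 8): the FF analogue behaves exactly as the crux predicts.
* §H  SECOND-ORDER STRUCTURE (numerics, heuristic): generic prime pairs carry Chebyshev's bias (naive main term
  NEGATIVE, ≍ x^{1−θ/2}/log²x ≫ √x) but crux events do not (J > 0 at every x ≥ 5·10⁵; small-m classes +0.003 at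
  10⁷, decaying): `E[c_x(QQ')] = 4x/(QQ')` fails at second order in a (Q|Q')-correlated way — warning for provers.
* §E  NEAR-MISSES / refuted strengthenings kept with `sorry` and data (see docstrings).

Numerics on the ledger item (other seats, x ≤ 10⁷): |J_θ|/√N_θ ≤ 2.7, J/N ≤ 6·10⁻³ decreasing,
N_θ/x = 0.215 (θ=0.6) … 0.0086 (θ=0.9); cofactor classes, mod-8 classes, m = 1 (t²+1 = QQ')
unbiased (mean +0.0023 on 585175 pairs); negative-Pell/Scholz bias sits at the quartic level only.
This seat (local, ff/blocks.py, X = 3·10⁶, 30 blocks of t): cumulative J/√N = +1.30, +1.32, +2.16, +1.87 at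
θ = 0.55, 0.6, 0.7, 0.8; mean block z = +0.27 (se 0.19), +0.26 (0.17), +0.41 (0.19), +0.39 (0.19), block variance
0.86–1.09: noise-like blocks with a WEAK systematic positive component ≈ +1.6√N in total (1.5–2σ per θ; the same sign
every seat saw at every x ≥ 5·10⁵) — an O(√x)-size effect (coherent families, §D), irrelevant to o(x); kit j006246
(10⁸) settles it — KILL-SCALE TABLE (kit j014067, X = 10⁸, the planner's kill criterion; table_1e8.md on the item):
`θ = .51: J = −7875 (z = −1.3)`; `θ = .55, .6, .65, .7, .75, .8, .85, .9, .95: J = +1685, +7265, +8402, +4720, +6015, +3217,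
+1601, +2111, +434`, `z = +0.3 … +2.3`, `J/N ≤ 2.3·10⁻³` (`≤ 8.4·10⁻⁴` for `θ ≤ .85`) and DECREASING from 10⁷ at every θ
(θ = .6: 6.7·10⁻⁴ → 3.3·10⁻⁴; θ = .9: 5.8·10⁻³ → 2.3·10⁻³); 6905 cofactor classes (N ≥ 100) have z-scores of mean 0.000,
variance 1.008, max |z| = 3.86 (pure noise); 25 t-blocks: variance 0.9–1.5, mean z +0.37/+0.51/+0.57 at θ = .6/.75/.9;
small-cofactor classes m ∈ {1,2,5,10}: mean +0.0031 → +0.0020 → +0.0017 → +0.0008 from 1.25·10⁷ to 10⁸ (≈ x^{−1/2}: an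
O(√x) forced-square effect, not a bias). NO DRIFT: the crux SURVIVES its kill criterion.
WHY IT RESISTS (accounting, for provers). Modulus-side form: J_θ(x) = Σ_{x^θ<Q<Q'} (Q|Q')·c_x(QQ'),
c_x(n) = #{t ≤ x : n ∣ t²+1} ∈ {0,…,4} for n > x. (1) Main term Σ (Q|Q')·4x/(QQ') = o(x) IS provable
(equidistribution of (Q|Q') over primes in boxes: Siegel–Walfisz / Heath-Brown's quadratic large sieve).
(2) The fluctuation c_x(n) − 4x/n expands (Poisson) into root fractions e(hν/(QQ')), ν/(QQ') ≡ ν_Q·Q̄'/Q +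
ν_{Q'}·Q̄/Q' (mod 1), h ≤ QQ'/x: a bilinear form in (Q, Q') with kernel (Q|Q') × Salié/Kloosterman-type root
fractions. (3) Cauchy–Schwarz over the SMALLER prime Q ~ x^θ: diagonal ≍ x·x^θ (fine: gives x^{(1+θ)/2}), but
the off-diagonal Σ_Q Σ_{t₁≠t₂ ≡ roots (Q)} (Q'₁Q'₂|Q) needs (Q'ᵢ|Q) = ((tᵢ²+1)/(Q mᵢ) | Q)·… = (c_ν + 2νk | Q)·(mᵢ|Q):
LINEAR in k = (t−ν)/Q of length x/Q = Q^{(1−θ)/θ} — Burgess-admissible iff θ < 4/5 — but ONLY after the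
primality of Q'ᵢ = (tᵢ²+1)/(Qmᵢ) is opened by a sieve identity, whose Type-II part is Σ_{r,s} α_r β_s (r|Q)(s|Q)
·1[Q m r s − 1 = □ ≤ x²]: a bilinear form at LEVEL 2 (the modulus Qmrs is all of t²+1), where Cauchy–Schwarz has
no off-diagonal to win from (simultaneous Pell conditions) — the self-similar wall. (4) C–S over the LARGER prime
needs character sums over primes Q' ~ x^{1+δ−θ} to modulus Q₁Q₂ ~ x^{2θ} > their length: hopeless for θ > 1/2.
(5) Gaussian bookkeeping t+i = ε·μ·π·π' gives (Q|Q') = [π'/π]₂·(2|Q')^{1+[ε=±i]}·[μ̄/π']₂ (π, π' primary): a FREE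
spin symbol with no quadratic-level reciprocity constraint (negative Pell along t²+1 is automatic; the Scholz
constraint is quartic and was confirmed numerically: 0 mixed quartic pairs / 293254, rattack). §F puts this in
SL₂(ℤ) coordinates: the symbol is the spin (1+2bc | c²+d²), horocycle-periodic, one point per horocycle once
c²+d² > x. So neither a bias mechanism nor a cancellation mechanism is visible: open, Type-II-at-level-2 hard.
-/

namespace Summit.Parity.BatemanHorn.Cruxes.SplitBlockJacobi.Disproof

open Finset Filter Asymptotics
open Summit.Parity.BatemanHorn.Theses.IsogenyRedei (SplitBlockJacobi)

/-! ## §0 The crux's function -/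

/-- The pair set of the crux at parameters `θ`, `x`, `t`: ordered pairs `(Q, Q')` of prime factors of
`t² + 1` with `x^θ < Q < Q'`. -/
noncomputable def pairs (θ : ℝ) (x t : ℕ) : Finset (ℕ × ℕ) :=
  ((t ^ 2 + 1).primeFactors ×ˢ (t ^ 2 + 1).primeFactors).filter
    (fun q : ℕ × ℕ => (x : ℝ) ^ θ < (q.1 : ℝ) ∧ q.1 < q.2)

/-- `J θ x = J_θ(x)`, the split-block Jacobi sum of the crux. -/
noncomputable def J (θ : ℝ) (x : ℕ) : ℝ :=
  ∑ t ∈ Icc 1 x, ∑ q ∈ pairs θ x t, (jacobiSym (q.1 : ℤ) q.2 : ℝ)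

/-- The crux, restated through `J` (definitionally). -/
theorem splitBlockJacobi_iff :
    SplitBlockJacobi ↔
      ∀ θ : ℝ, 1 / 2 < θ → θ < 1 → (fun x : ℕ => J θ x) =o[atTop] fun x : ℕ => (x : ℝ) :=
  Iff.rfl

/-! ## §A Load-bearing analysis -/

/-- Membership in the pair set, unfolded. -/
theorem mem_pairs {θ : ℝ} {x t : ℕ} {q : ℕ × ℕ} :
    q ∈ pairs θ x t ↔
      (q.1 ∈ (t ^ 2 + 1).primeFactors ∧ q.2 ∈ (t ^ 2 + 1).primeFactors) ∧
        (x : ℝ) ^ θ < (q.1 : ℝ) ∧ q.1 < q.2 := by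
  simp [pairs, Finset.mem_filter, Finset.mem_product]

/-- Two distinct prime factors of `n` have product dividing `n`. -/
theorem mul_dvd_of_mem_primeFactors {n Q Q' : ℕ} (hQ : Q ∈ n.primeFactors)
    (hQ' : Q' ∈ n.primeFactors) (hne : Q ≠ Q') : Q * Q' ∣ n := by
  rw [Nat.mem_primeFactors] at hQ hQ'
  exact ((Nat.coprime_primes hQ.1 hQ'.1).mpr hne).mul_dvd_of_dvd_of_dvd hQ.2.1 hQ'.2.1

/-- For `θ ≥ 1` the pair set is EMPTY: `Q > x^θ ≥ x` forces `Q ≥ x+1`, `Q' ≥ x+2`, and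
`QQ' ∣ t²+1 ≤ x²+1 < (x+1)(x+2)`. -/
theorem pairs_eq_empty_of_one_le {θ : ℝ} (hθ : 1 ≤ θ) {x t : ℕ} (ht : t ∈ Icc 1 x) :
    pairs θ x t = ∅ := by
  rw [Finset.eq_empty_iff_forall_notMem]
  rintro ⟨Q, Q'⟩ hq
  rw [mem_pairs] at hq
  obtain ⟨⟨hQ, hQ'⟩, hxQ, hQQ'⟩ := hq
  rw [Finset.mem_Icc] at ht
  obtain ⟨h1t, htx⟩ := ht
  have hx1 : (1 : ℝ) ≤ x := by exact_mod_cast h1t.trans htx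
  have hxle : (x : ℝ) ≤ (x : ℝ) ^ θ := by
    calc (x : ℝ) = (x : ℝ) ^ (1 : ℝ) := (Real.rpow_one _).symm
      _ ≤ (x : ℝ) ^ θ := Real.rpow_le_rpow_of_exponent_le hx1 hθ
  have hxQ' : (x : ℝ) < Q := hxle.trans_lt hxQ
  have hxQn : x < Q := by exact_mod_cast hxQ'
  have hdvd : Q * Q' ∣ t ^ 2 + 1 := mul_dvd_of_mem_primeFactors hQ hQ' (Nat.ne_of_lt hQQ')
  have hle : Q * Q' ≤ t ^ 2 + 1 := Nat.le_of_dvd (Nat.succ_pos _) hdvd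
  have h1 : x + 1 ≤ Q := hxQn
  have h2 : x + 2 ≤ Q' := by omega
  have h3 : (x + 1) * (x + 2) ≤ Q * Q' := Nat.mul_le_mul h1 h2
  have h4 : t ^ 2 ≤ x ^ 2 := Nat.pow_le_pow_left htx 2
  nlinarith

/-- Hence `J_θ ≡ 0` for `θ ≥ 1`. -/
theorem J_eq_zero_of_one_le {θ : ℝ} (hθ : 1 ≤ θ) (x : ℕ) : J θ x = 0 := by
  unfold J
  refine Finset.sum_eq_zero fun t ht => ?_
  rw [pairs_eq_empty_of_one_le hθ ht, Finset.sum_empty]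

/-- … so `J_θ = o(x)` holds trivially for `θ ≥ 1`. -/
theorem isLittleO_J_of_one_le {θ : ℝ} (hθ : 1 ≤ θ) :
    (fun x : ℕ => J θ x) =o[atTop] fun x : ℕ => (x : ℝ) := by
  have h : (fun x : ℕ => J θ x) = fun _ => (0 : ℝ) := funext (J_eq_zero_of_one_le hθ)
  rw [h]
  exact Asymptotics.isLittleO_zero _ _

/-- The crux with the hypothesis `θ < 1` DROPPED. -/
def SplitBlockJacobiWithoutUpper : Prop :=
  ∀ θ : ℝ, 1 / 2 < θ → (fun x : ℕ => J θ x) =o[atTop] fun x : ℕ => (x : ℝ)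

/-- (a) `θ < 1` is not load-bearing: the crux is EQUIVALENT to its version without the upper bound
(the range `θ ≥ 1` is vacuous). Any proof may ignore `θ < 1`; any disproof must use `θ < 1`
only through `Q ≤ x`. -/
theorem splitBlockJacobi_iff_withoutUpper : SplitBlockJacobi ↔ SplitBlockJacobiWithoutUpper := by
  rw [splitBlockJacobi_iff]
  constructor
  · intro h θ hθ
    by_cases h1 : θ < 1
    · exact h θ hθ h1
    · exact isLittleO_J_of_one_le (not_lt.mp h1)
  · intro h θ hθ _
    exact h θ hθ

/-- The crux with the hypothesis `1/2 < θ` DROPPED (all `θ < 1`, in particular `θ ≤ 0`, where for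
`x ≥ 2` EVERY pair of distinct prime factors of `t²+1` is counted, `Q = 2` included). -/
def SplitBlockJacobiWithoutLower : Prop :=
  ∀ θ : ℝ, θ < 1 → (fun x : ℕ => J θ x) =o[atTop] fun x : ℕ => (x : ℝ)

/-! ## §B Arithmetic of the pairs -/

/-- Every prime factor `Q ≠ 2` of `t² + 1` is `≡ 1 (mod 4)` (−1 is a square mod `Q`). -/
theorem mod_four_eq_one_of_mem_primeFactors {t Q : ℕ} (hQ : Q ∈ (t ^ 2 + 1).primeFactors)
    (hQ2 : Q ≠ 2) : Q % 4 = 1 := by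
  rw [Nat.mem_primeFactors] at hQ
  obtain ⟨hp, hdvd, -⟩ := hQ
  haveI := Fact.mk hp
  have h0 : ((t ^ 2 + 1 : ℕ) : ZMod Q) = 0 := (ZMod.natCast_eq_zero_iff _ _).mpr hdvd
  have hsq : ((t : ZMod Q)) ^ 2 = -1 := by
    push_cast at h0
    linear_combination h0
  have h3 := ZMod.mod_four_ne_three_of_sq_eq_neg_one hsq
  have hodd : Q % 2 = 1 := Nat.odd_iff.mp (hp.odd_of_ne_two hQ2)
  omega

/-- For `x ≥ 4` and `θ > 1/2` the smaller prime of a pair exceeds `2` (`x^θ ≥ 4^{1/2} = 2`). -/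
theorem two_lt_of_mem_pairs {θ : ℝ} {x t : ℕ} {q : ℕ × ℕ} (hx : 4 ≤ x) (hθ : 1 / 2 < θ)
    (hq : q ∈ pairs θ x t) : 2 < q.1 := by
  rw [mem_pairs] at hq
  obtain ⟨-, hxQ, -⟩ := hq
  have hx1 : (1 : ℝ) ≤ x := by exact_mod_cast (show 1 ≤ x by omega)
  have hx4 : (4 : ℝ) ≤ x := by exact_mod_cast hx
  have h4 : (4 : ℝ) ^ ((1 : ℝ) / 2) = 2 := by
    rw [show (4 : ℝ) = 2 ^ (2 : ℝ) by norm_num, ← Real.rpow_mul (by norm_num)]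
    norm_num
  have h2 : (2 : ℝ) ≤ (x : ℝ) ^ θ := by
    calc (2 : ℝ) = (4 : ℝ) ^ ((1 : ℝ) / 2) := h4.symm
      _ ≤ (x : ℝ) ^ ((1 : ℝ) / 2) := Real.rpow_le_rpow (by norm_num) hx4 (by norm_num)
      _ ≤ (x : ℝ) ^ θ := Real.rpow_le_rpow_of_exponent_le hx1 hθ.le
  exact_mod_cast h2.trans_lt hxQ

/-- On every pair of the sum (for `x ≥ 4`, `θ > 1/2`) both primes are `≡ 1 (mod 4)` … -/
theorem mod_four_of_mem_pairs {θ : ℝ} {x t : ℕ} {q : ℕ × ℕ} (hx : 4 ≤ x) (hθ : 1 / 2 < θ)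
    (hq : q ∈ pairs θ x t) : q.1 % 4 = 1 ∧ q.2 % 4 = 1 := by
  have h2 := two_lt_of_mem_pairs hx hθ hq
  rw [mem_pairs] at hq
  obtain ⟨⟨hQ, hQ'⟩, -, hQQ'⟩ := hq
  exact ⟨mod_four_eq_one_of_mem_primeFactors hQ (by omega),
    mod_four_eq_one_of_mem_primeFactors hQ' (by omega)⟩

/-- … hence the summand is symmetric: `(Q|Q') = (Q'|Q)` — one well-defined sign per value `t²+1`
(quadratic reciprocity, both entries `≡ 1 (mod 4)`). -/
theorem jacobiSym_symm_of_mem_pairs {θ : ℝ} {x t : ℕ} {q : ℕ × ℕ} (hx : 4 ≤ x) (hθ : 1 / 2 < θ)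
    (hq : q ∈ pairs θ x t) : jacobiSym (q.1 : ℤ) q.2 = jacobiSym (q.2 : ℤ) q.1 := by
  obtain ⟨h1, h2⟩ := mod_four_of_mem_pairs hx hθ hq
  exact jacobiSym.quadratic_reciprocity_one_mod_four h1 (Nat.odd_iff.mpr (by omega))

/-- Divisibility alone does not constrain the sign: `t = 8`, `t²+1 = 65 = 5·13`, `(5|13) = −1`. -/
theorem sign_neg_example :
    (5 : ℕ) ∈ (8 ^ 2 + 1).primeFactors ∧ (13 : ℕ) ∈ (8 ^ 2 + 1).primeFactors ∧
      jacobiSym 5 13 = -1 :=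
  ⟨Nat.mem_primeFactors.mpr ⟨by norm_num, by norm_num, by norm_num⟩,
    Nat.mem_primeFactors.mpr ⟨by norm_num, by norm_num, by norm_num⟩, by norm_num⟩

/-- … and `t = 12`, `t²+1 = 145 = 5·29`, `(5|29) = +1`. -/
theorem sign_pos_example :
    (5 : ℕ) ∈ (12 ^ 2 + 1).primeFactors ∧ (29 : ℕ) ∈ (12 ^ 2 + 1).primeFactors ∧
      jacobiSym 5 29 = 1 :=
  ⟨Nat.mem_primeFactors.mpr ⟨by norm_num, by norm_num, by norm_num⟩,
    Nat.mem_primeFactors.mpr ⟨by norm_num, by norm_num, by norm_num⟩, by norm_num⟩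

/-- Every pair of distinct primes `Q ≡ Q' ≡ 1 (mod 4)` divides SOME `t² + 1` (CRT on square roots
of −1): the set of sign-carrying pairs is ALL such pairs; only the size condition `t ≤ x` (a small
root of −1 modulo `QQ'`) couples the pair to the count. -/
theorem exists_t_of_primes {Q Q' : ℕ} (hQ : Q.Prime) (hQ' : Q'.Prime) (hQ4 : Q % 4 = 1)
    (hQ'4 : Q' % 4 = 1) (hne : Q ≠ Q') : ∃ t : ℕ, Q * Q' ∣ t ^ 2 + 1 := by
  haveI := Fact.mk hQ
  haveI := Fact.mk hQ'
  obtain ⟨a, ha⟩ := (ZMod.exists_sq_eq_neg_one_iff (p := Q)).mpr (by omega)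
  obtain ⟨b, hb⟩ := (ZMod.exists_sq_eq_neg_one_iff (p := Q')).mpr (by omega)
  -- CRT: pick t with t ≡ a (Q), t ≡ b (Q')
  have hcop : Nat.Coprime Q Q' := (Nat.coprime_primes hQ hQ').mpr hne
  obtain ⟨t, ht⟩ := Nat.chineseRemainder hcop a.val b.val
  refine ⟨t, hcop.mul_dvd_of_dvd_of_dvd ?_ ?_⟩
  · rw [← ZMod.natCast_eq_zero_iff]
    have h1 : (t : ZMod Q) = a := by
      rw [(ZMod.natCast_eq_natCast_iff _ _ _).mpr ht.1, ZMod.natCast_val, ZMod.cast_id', id]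
    push_cast
    rw [h1]
    linear_combination (-1 : ZMod Q) * ha
  · rw [← ZMod.natCast_eq_zero_iff]
    have h1 : (t : ZMod Q') = b := by
      rw [(ZMod.natCast_eq_natCast_iff _ _ _).mpr ht.2, ZMod.natCast_val, ZMod.cast_id', id]
    push_cast
    rw [h1]
    linear_combination (-1 : ZMod Q') * hb

/-- RANGE of the pairs: `Q·Q' ∣ t²+1 ≤ x²+1`, hence `Q ≤ x` (the effective range of the smaller prime
is `(x^θ, x]`) … -/
theorem mul_le_of_mem_pairs {θ : ℝ} {x t : ℕ} {q : ℕ × ℕ} (ht : t ∈ Icc 1 x) (hq : q ∈ pairs θ x t) :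
    q.1 * q.2 ≤ x ^ 2 + 1 ∧ q.1 ≤ x := by
  rw [mem_pairs] at hq
  obtain ⟨⟨hQ, hQ'⟩, -, hQQ'⟩ := hq
  rw [Finset.mem_Icc] at ht
  have hdvd : q.1 * q.2 ∣ t ^ 2 + 1 := mul_dvd_of_mem_primeFactors hQ hQ' (Nat.ne_of_lt hQQ')
  have hle : q.1 * q.2 ≤ t ^ 2 + 1 := Nat.le_of_dvd (Nat.succ_pos _) hdvd
  have h4 : t ^ 2 ≤ x ^ 2 := Nat.pow_le_pow_left ht.2 2
  refine ⟨by omega, ?_⟩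
  by_contra hx
  rw [not_le] at hx
  have h1 : x + 1 ≤ q.1 := hx
  have h2 : x + 2 ≤ q.2 := by omega
  have h3 : (x + 1) * (x + 2) ≤ q.1 * q.2 := Nat.mul_le_mul h1 h2
  nlinarith

/-- … and `x < Q·Q'` (for `x ≥ 1`): every modulus `QQ'` of the crux lies BEYOND `x` — the count
`#{t ≤ x : QQ' ∣ t²+1}` is a small-root count in `{0,…,4}`, not an equidistributed quantity `≍ x/(QQ')`. -/
theorem lt_mul_of_mem_pairs {θ : ℝ} (hθ : 1 / 2 < θ) {x t : ℕ} {q : ℕ × ℕ} (ht : t ∈ Icc 1 x)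
    (hq : q ∈ pairs θ x t) : x < q.1 * q.2 := by
  rw [mem_pairs] at hq
  obtain ⟨-, hxQ, hQQ'⟩ := hq
  rw [Finset.mem_Icc] at ht
  have hx1 : (1 : ℝ) ≤ x := by exact_mod_cast ht.1.trans ht.2
  have hxpos : (0 : ℝ) ≤ x := by linarith
  -- x^{1/2} ≤ x^θ < Q, so x < Q² < Q·Q'
  have h1 : (x : ℝ) ^ ((1 : ℝ) / 2) ≤ (x : ℝ) ^ θ := Real.rpow_le_rpow_of_exponent_le hx1 hθ.le
  have h2 : (x : ℝ) ^ ((1 : ℝ) / 2) < q.1 := h1.trans_lt hxQ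
  have h3 : (x : ℝ) < (q.1 : ℝ) ^ 2 := by
    have hs : ((x : ℝ) ^ ((1 : ℝ) / 2)) ^ 2 = x := by
      rw [← Real.rpow_natCast, ← Real.rpow_mul hxpos]; norm_num
    rw [← hs]
    exact pow_lt_pow_left₀ h2 (by positivity) two_ne_zero
  have h4 : x < q.1 ^ 2 := by exact_mod_cast h3
  have h5 : q.1 ^ 2 ≤ q.1 * q.2 := by rw [sq]; exact Nat.mul_le_mul_left _ hQQ'.le
  omega

/-- MODULUS-SIDE FORM (Fubini): `J_θ(x) = Σ_{(Q,Q')} (Q|Q') · #{t ≤ x : (Q,Q') ∈ pairs θ x t}`, the sum running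
over the finitely many pairs that occur. With `lt_mul_of_mem_pairs`, each multiplicity is a count of roots of
`−1 (mod QQ')` in `[1, x] ⊊ [1, QQ')`, i.e. in `{0,…,4}`. -/
theorem J_eq_sum_pairs_mul_card (θ : ℝ) (x : ℕ) :
    J θ x = ∑ q ∈ (Icc 1 x).biUnion (pairs θ x),
      (((Icc 1 x).filter (fun t => q ∈ pairs θ x t)).card : ℝ) * (jacobiSym (q.1 : ℤ) q.2 : ℝ) := by
  unfold J
  rw [Finset.sum_comm' (t' := (Icc 1 x).biUnion (pairs θ x))
    (s' := fun q => (Icc 1 x).filter (fun t => q ∈ pairs θ x t))]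
  · refine Finset.sum_congr rfl fun q _ => ?_
    rw [Finset.sum_const, nsmul_eq_mul]
  · intro t q
    simp only [Finset.mem_filter, Finset.mem_biUnion]
    constructor
    · rintro ⟨ht, hq⟩
      exact ⟨⟨ht, hq⟩, t, ht, hq⟩
    · rintro ⟨⟨ht, hq⟩, -⟩
      exact ⟨ht, hq⟩

/-! ## §C Tightness: the trivial bound `J_θ = O(x)` (the crux is exactly the `o` versus `O` gap) -/

/-- The large prime factors of `t² + 1` at scale `x^θ`. -/
noncomputable def bigFactors (θ : ℝ) (x t : ℕ) : Finset ℕ :=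
  (t ^ 2 + 1).primeFactors.filter (fun p => (x : ℝ) ^ θ < p)

/-- The pairs are pairs of large prime factors. -/
theorem pairs_subset_product (θ : ℝ) (x t : ℕ) :
    pairs θ x t ⊆ bigFactors θ x t ×ˢ bigFactors θ x t := by
  intro q hq
  rw [mem_pairs] at hq
  obtain ⟨⟨h1, h2⟩, hxq, hlt⟩ := hq
  simp only [bigFactors, Finset.mem_product, Finset.mem_filter]
  exact ⟨⟨h1, hxq⟩, h2, hxq.trans (by exact_mod_cast hlt)⟩

/-- The explicit threshold beyond which four primes `> x^θ` cannot divide a number `≤ x² + 1`. -/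
noncomputable def x₀ (θ : ℝ) : ℕ := ⌈(2 : ℝ) ^ (1 / (4 * θ - 2))⌉₊

/-- For `x ≥ x₀(θ)`: `x^{4θ−2} ≥ 2`. -/
theorem two_le_rpow_of_x₀_le {θ : ℝ} (hθ : 1 / 2 < θ) {x : ℕ} (hx : x₀ θ ≤ x) :
    (2 : ℝ) ≤ (x : ℝ) ^ (4 * θ - 2) := by
  have hpos : 0 < 4 * θ - 2 := by linarith
  have h1 : (2 : ℝ) ^ (1 / (4 * θ - 2)) ≤ x := (Nat.le_ceil _).trans (by exact_mod_cast hx)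
  calc (2 : ℝ) = ((2 : ℝ) ^ (1 / (4 * θ - 2))) ^ (4 * θ - 2) := by
        rw [← Real.rpow_mul (by norm_num), one_div_mul_cancel hpos.ne', Real.rpow_one]
    _ ≤ (x : ℝ) ^ (4 * θ - 2) := Real.rpow_le_rpow (by positivity) h1 hpos.le

/-- COMBINATORIAL HEART of `1/2 < θ`: for `x ≥ x₀(θ)` and `1 ≤ t ≤ x`, at most THREE primes `> x^θ` divide
`t² + 1` (four of them would have product `> x^{4θ} ≥ 2x² > x² + 1 ≥ t² + 1`). -/
theorem card_bigFactors_le_three {θ : ℝ} (hθ : 1 / 2 < θ) {x t : ℕ} (hx : x₀ θ ≤ x)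
    (ht : t ∈ Icc 1 x) : (bigFactors θ x t).card ≤ 3 := by
  by_contra hlt
  rw [not_le] at hlt
  obtain ⟨S', hS', hcard⟩ := Finset.exists_subset_card_eq (show 4 ≤ (bigFactors θ x t).card from hlt)
  rw [Finset.mem_Icc] at ht
  have hx1 : (1 : ℝ) ≤ x := by exact_mod_cast ht.1.trans ht.2
  have hxpos : (0 : ℝ) < x := by linarith
  have hmem : ∀ p ∈ S', p.Prime ∧ p ∣ t ^ 2 + 1 ∧ (x : ℝ) ^ θ < p := by
    intro p hp
    have h := hS' hp
    simp only [bigFactors, Finset.mem_filter, Nat.mem_primeFactors] at h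
    exact ⟨h.1.1, h.1.2.1, h.2⟩
  have hdvd : ∏ p ∈ S', p ∣ t ^ 2 + 1 :=
    Finset.prod_primes_dvd (t ^ 2 + 1) (fun p hp => (hmem p hp).1.prime) (fun p hp => (hmem p hp).2.1)
  have hle : (∏ p ∈ S', (p : ℝ)) ≤ (x : ℝ) ^ 2 + 1 := by
    have h1 : ∏ p ∈ S', p ≤ t ^ 2 + 1 := Nat.le_of_dvd (Nat.succ_pos _) hdvd
    have h2 : t ^ 2 ≤ x ^ 2 := Nat.pow_le_pow_left ht.2 2
    have h3 : ((∏ p ∈ S', p : ℕ) : ℝ) ≤ ((x ^ 2 + 1 : ℕ) : ℝ) := by exact_mod_cast h1.trans (by omega)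
    push_cast at h3
    exact h3
  have hgt : (x : ℝ) ^ (4 * θ) < ∏ p ∈ S', (p : ℝ) := by
    have hS'ne : S'.Nonempty := by rw [← Finset.card_pos, hcard]; norm_num
    calc (x : ℝ) ^ (4 * θ) = ((x : ℝ) ^ θ) ^ (4 : ℕ) := by
          rw [← Real.rpow_natCast, ← Real.rpow_mul hxpos.le]
          norm_num [mul_comm]
      _ = ∏ _p ∈ S', (x : ℝ) ^ θ := by rw [Finset.prod_const, hcard]
      _ < ∏ p ∈ S', (p : ℝ) :=
          Finset.prod_lt_prod_of_nonempty (fun p _ => by positivity) (fun p hp => (hmem p hp).2.2) hS'ne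
  have h2 : (2 : ℝ) ≤ (x : ℝ) ^ (4 * θ - 2) := two_le_rpow_of_x₀_le hθ hx
  have hsplit : (x : ℝ) ^ (4 * θ) = (x : ℝ) ^ 2 * (x : ℝ) ^ (4 * θ - 2) := by
    rw [← Real.rpow_two, ← Real.rpow_add hxpos]
    ring_nf
  have h3 : (x : ℝ) ^ 2 * 2 ≤ (x : ℝ) ^ (4 * θ) := by
    rw [hsplit]
    exact mul_le_mul_of_nonneg_left h2 (by positivity)
  nlinarith

/-- Hence at most `3² = 9` ordered pairs (sharp count: 3); the summand is a sign, so `|inner sum| ≤ 9`. -/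
theorem abs_inner_le_nine {θ : ℝ} (hθ : 1 / 2 < θ) {x t : ℕ} (hx : x₀ θ ≤ x) (ht : t ∈ Icc 1 x) :
    |∑ q ∈ pairs θ x t, (jacobiSym (q.1 : ℤ) q.2 : ℝ)| ≤ 9 := by
  have hj : ∀ q : ℕ × ℕ, |(jacobiSym (q.1 : ℤ) q.2 : ℝ)| ≤ 1 := by
    intro q
    rcases jacobiSym.trichotomy (q.1 : ℤ) q.2 with h | h | h <;> simp [h]
  have hcard : ((pairs θ x t).card : ℝ) ≤ 9 := by
    have h1 := Finset.card_le_card (pairs_subset_product θ x t)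
    rw [Finset.card_product] at h1
    have h3 := card_bigFactors_le_three hθ hx ht
    have h9 : (pairs θ x t).card ≤ 9 := h1.trans (by nlinarith)
    exact_mod_cast h9
  calc |∑ q ∈ pairs θ x t, (jacobiSym (q.1 : ℤ) q.2 : ℝ)|
      ≤ ∑ q ∈ pairs θ x t, |(jacobiSym (q.1 : ℤ) q.2 : ℝ)| := Finset.abs_sum_le_sum_abs _ _
    _ ≤ ∑ _q ∈ pairs θ x t, (1 : ℝ) := Finset.sum_le_sum fun q _ => hj q
    _ = (pairs θ x t).card := by simp
    _ ≤ 9 := hcard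

/-- (b) TIGHTNESS / trivial bound: `|J_θ(x)| ≤ 9x` for `x ≥ x₀(θ)`. -/
theorem abs_J_le {θ : ℝ} (hθ : 1 / 2 < θ) {x : ℕ} (hx : x₀ θ ≤ x) : |J θ x| ≤ 9 * x := by
  unfold J
  calc |∑ t ∈ Icc 1 x, ∑ q ∈ pairs θ x t, (jacobiSym (q.1 : ℤ) q.2 : ℝ)|
      ≤ ∑ t ∈ Icc 1 x, |∑ q ∈ pairs θ x t, (jacobiSym (q.1 : ℤ) q.2 : ℝ)| :=
        Finset.abs_sum_le_sum_abs _ _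
    _ ≤ ∑ _t ∈ Icc 1 x, (9 : ℝ) := Finset.sum_le_sum fun t ht => abs_inner_le_nine hθ hx ht
    _ = 9 * x := by simp [mul_comm]

/-- (b) The crux's function is `O(x)` UNCONDITIONALLY: `SplitBlockJacobi` asserts exactly the cancellation
`o(x)` beyond this trivial bound (trivial mass `N_θ(x) ≍_θ x`, measured 0.215x at θ = 0.6, 0.0086x at θ = 0.9). -/
theorem isBigO_J {θ : ℝ} (hθ : 1 / 2 < θ) :
    (fun x : ℕ => J θ x) =O[atTop] fun x : ℕ => (x : ℝ) := by
  refine Asymptotics.IsBigO.of_bound 9 ?_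
  rw [Filter.eventually_atTop]
  refine ⟨x₀ θ, fun x hx => ?_⟩
  rw [Real.norm_eq_abs, Real.norm_eq_abs, Nat.abs_cast]
  exact abs_J_le hθ hx

/-! ## §D Sign-coherent algebraic sub-families (refuted strengthening: "equidistribution along families")

The Aurifeuillian factorisation `(2m²)² + 1 = (2m² − 2m + 1)(2m² + 2m + 1) = A_m · B_m`
(`A_m = m² + (m−1)²`, `B_m = m² + (m+1)² = A_{m+1}`) puts `t = 2m²` in the summation range with the pair
`(A_m, B_m)` whenever both are prime and `A_m > x^θ` (≍ √x / log² x members up to x, conjecturally).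
SIGN LAW (checked for m < 3000 in job j004900; PROVED below in full, `jacobiSym_aur`):
`(A_m | B_m) = −1` iff `m ≡ 2 (mod 4)`, `= +1` otherwise. So the summation set of the crux contains INFINITE
explicit sub-families on which the sign is CONSTANT: the cancellation asserted by `SplitBlockJacobi` cannot be a
property of `(Q|Q')` along algebraic families of factorisations `t + i = (a+bi)(c+di)` (all of which carry
PERIODIC signs by polynomial reciprocity); it can only come from the sparsity (O(√x)) of each family and
cancellation ACROSS families. This also explains the persistent positive offset `J_θ ≈ +(1…2.7)√N_θ` seen
by every seat at x ≤ 10⁷ (net sign +1/2 per member here). -/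

/-- `B_m = 2m² + 2m + 1 ≡ 1 (mod m)`. -/
theorem bAur_mod (m : ℕ) : ((2 * m ^ 2 + 2 * m + 1 : ℕ) : ℤ) % (m : ℤ) = 1 % (m : ℤ) := by
  have h : ((2 * m ^ 2 + 2 * m + 1 : ℕ) : ℤ) = 1 + (m : ℤ) * (2 * m + 2) := by push_cast; ring
  rw [h, Int.add_mul_emod_self_left]

/-- `(A_m | B_m) = (m | B_m)`: `A_m ≡ −4m (mod B_m)`, `(−1|B_m) = (4|B_m) = 1`. -/
theorem jacobiSym_aur_eq (m : ℕ) (hm : 1 ≤ m) :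
    jacobiSym (2 * (m : ℤ) ^ 2 - 2 * m + 1) (2 * m ^ 2 + 2 * m + 1)
      = jacobiSym (m : ℤ) (2 * m ^ 2 + 2 * m + 1) := by
  set B : ℕ := 2 * m ^ 2 + 2 * m + 1 with hB
  have hBodd : Odd B := ⟨m ^ 2 + m, by rw [hB]; ring⟩
  have hB4 : B % 4 = 1 := by
    rw [hB]
    have : (2 * m ^ 2 + 2 * m) % 4 = 0 := by
      have h2 : m ^ 2 + m = m * (m + 1) := by ring
      rcases Nat.even_or_odd m with ⟨k, hk⟩ | ⟨k, hk⟩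
      · subst hk; ring_nf; omega
      · subst hk; ring_nf; omega
    omega
  have hmod : (2 * (m : ℤ) ^ 2 - 2 * m + 1) % (B : ℤ) = (-1 * (2 ^ 2 * (m : ℤ))) % (B : ℤ) := by
    have h : (2 * (m : ℤ) ^ 2 - 2 * m + 1) = (-1 * (2 ^ 2 * (m : ℤ))) + (B : ℤ) * 1 := by
      rw [hB]; push_cast; ring
    rw [h, Int.add_mul_emod_self_left]
  rw [jacobiSym.mod_left' hmod, jacobiSym.mul_left, jacobiSym.mul_left, jacobiSym.at_neg_one hBodd,
    ZMod.χ₄_nat_one_mod_four hB4, jacobiSym.sq_one' (a := 2) ?_]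
  · ring
  · -- gcd(2, B) = 1 since B is odd
    rw [show (2 : ℤ) = ((2 : ℕ) : ℤ) from rfl, Int.gcd_natCast_natCast]
    exact Nat.Coprime.gcd_eq_one ((Nat.coprime_two_left).mpr hBodd)

/-- POSITIVELY COHERENT FAMILY: for odd `m`, `(A_m | B_m) = +1`
(`(m|B_m) = (B_m|m) = (1|m) = 1` by reciprocity, `B_m ≡ 1 (mod 4)`). -/
theorem jacobiSym_aur_of_odd {m : ℕ} (hm : Odd m) :
    jacobiSym (2 * (m : ℤ) ^ 2 - 2 * m + 1) (2 * m ^ 2 + 2 * m + 1) = 1 := by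
  have hm1 : 1 ≤ m := hm.pos
  rw [jacobiSym_aur_eq m hm1]
  have hB4 : (2 * m ^ 2 + 2 * m + 1) % 4 = 1 := by
    obtain ⟨k, hk⟩ := hm
    subst hk; ring_nf; omega
  rw [jacobiSym.quadratic_reciprocity_one_mod_four' hm hB4, jacobiSym.mod_left' (bAur_mod m),
    jacobiSym.one_left]

/-- NEGATIVELY COHERENT FAMILY: for `m ≡ 2 (mod 4)`, `(A_m | B_m) = −1`
(`m = 2m₀`, `m₀` odd: `(m|B_m) = (2|B_m)(m₀|B_m)`, `(m₀|B_m) = (B_m|m₀) = 1`, and `B_m ≡ 5 (mod 8)` so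
`(2|B_m) = −1`). E.g. `m = 2`: `t = 8`, `65 = 5 · 13`, `(5|13) = −1` (`sign_neg_example`). -/
theorem jacobiSym_aur_of_two_mod_four {m : ℕ} (hm : m % 4 = 2) :
    jacobiSym (2 * (m : ℤ) ^ 2 - 2 * m + 1) (2 * m ^ 2 + 2 * m + 1) = -1 := by
  have hm1 : 1 ≤ m := by omega
  rw [jacobiSym_aur_eq m hm1]
  obtain ⟨m₀, rfl⟩ : ∃ m₀, m = 2 * m₀ := ⟨m / 2, by omega⟩
  have hm₀ : Odd m₀ := Nat.odd_iff.mpr (by omega)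
  set B : ℕ := 2 * (2 * m₀) ^ 2 + 2 * (2 * m₀) + 1 with hB
  have hBodd : Odd B := ⟨(2 * m₀) ^ 2 + 2 * m₀, by rw [hB]; ring⟩
  have hB8 : B % 8 = 5 := by
    obtain ⟨k, hk⟩ := hm₀
    rw [hB, hk]; ring_nf; omega
  have hB4 : B % 4 = 1 := by omega
  have hcast : ((2 * m₀ : ℕ) : ℤ) = 2 * (m₀ : ℤ) := by push_cast; ring
  rw [hcast, jacobiSym.mul_left, jacobiSym.at_two hBodd, ZMod.χ₈_nat_eq_if_mod_eight]
  have hBm₀ : ((B : ℕ) : ℤ) % (m₀ : ℤ) = 1 % (m₀ : ℤ) := by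
    have h : ((B : ℕ) : ℤ) = 1 + (m₀ : ℤ) * (8 * m₀ + 4) := by rw [hB]; push_cast; ring
    rw [h, Int.add_mul_emod_self_left]
  rw [jacobiSym.quadratic_reciprocity_one_mod_four' hm₀ hB4, jacobiSym.mod_left' hBm₀,
    jacobiSym.one_left]
  simp [hB8, show B % 2 = 1 by omega]

/-- THIRD CASE: for `4 ∣ m` (m ≠ 0), `(A_m | B_m) = +1` (`m = 2^v m₀`: `(2|B_m) = 1` as `B_m ≡ 1 (mod 8)`, and
`(m₀|B_m) = (B_m|m₀) = 1`). -/
theorem jacobiSym_aur_of_four_dvd {m : ℕ} (hm : 4 ∣ m) (hm0 : m ≠ 0) :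
    jacobiSym (2 * (m : ℤ) ^ 2 - 2 * m + 1) (2 * m ^ 2 + 2 * m + 1) = 1 := by
  have hm1 : 1 ≤ m := Nat.pos_of_ne_zero hm0
  rw [jacobiSym_aur_eq m hm1]
  obtain ⟨v, m₀, hm₀, hvm⟩ := Nat.exists_eq_two_pow_mul_odd hm0
  set B : ℕ := 2 * m ^ 2 + 2 * m + 1 with hB
  have hBodd : Odd B := ⟨m ^ 2 + m, by rw [hB]; ring⟩
  have hB8 : B % 8 = 1 := by
    obtain ⟨j, rfl⟩ := hm
    rw [hB]; ring_nf; omega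
  have hB4 : B % 4 = 1 := by omega
  -- (2 | B) = 1
  have h2 : jacobiSym 2 B = 1 := by
    rw [jacobiSym.at_two hBodd, ZMod.χ₈_nat_eq_if_mod_eight]
    simp [hB8, show B % 2 = 1 by omega]
  -- (m₀ | B) = 1
  have hBm₀ : ((B : ℕ) : ℤ) % (m₀ : ℤ) = 1 % (m₀ : ℤ) := by
    have hdvd : (m₀ : ℤ) ∣ (m : ℤ) := by rw [hvm]; push_cast; exact Dvd.intro_left _ rfl
    obtain ⟨c, hc⟩ := hdvd
    have h : ((B : ℕ) : ℤ) = 1 + (m₀ : ℤ) * (c * (2 * m + 2)) := by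
      rw [hB]; push_cast; rw [hc]; ring
    rw [h, Int.add_mul_emod_self_left]
  have h₀ : jacobiSym (m₀ : ℤ) B = 1 := by
    rw [jacobiSym.quadratic_reciprocity_one_mod_four' hm₀ hB4, jacobiSym.mod_left' hBm₀, jacobiSym.one_left]
  have hcast : (m : ℤ) = 2 ^ v * (m₀ : ℤ) := by rw [hvm]; push_cast; ring
  rw [hcast, jacobiSym.mul_left, jacobiSym.pow_left, h2, h₀]
  simp

/-- THE AURIFEUILLIAN SIGN LAW in full (m ≥ 1): `(2m²−2m+1 | 2m²+2m+1) = −1` iff `m ≡ 2 (mod 4)`. -/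
theorem jacobiSym_aur (m : ℕ) (hm : 1 ≤ m) :
    jacobiSym (2 * (m : ℤ) ^ 2 - 2 * m + 1) (2 * m ^ 2 + 2 * m + 1) = if m % 4 = 2 then -1 else 1 := by
  by_cases h2 : m % 4 = 2
  · rw [if_pos h2]; exact jacobiSym_aur_of_two_mod_four h2
  · rw [if_neg h2]
    rcases Nat.even_or_odd m with he | ho
    · have h4 : 4 ∣ m := by obtain ⟨k, hk⟩ := he; omega
      exact jacobiSym_aur_of_four_dvd h4 (by omega)
    · exact jacobiSym_aur_of_odd ho

/-! ### §D′ The difference-square family (source of the POSITIVE secular term; cf. TRIAGE-r1-2)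

Since `(Q|Q') = (Q'|Q) = (Q' − Q | Q)`, every pair with `Q' − Q = 4s²` (`gcd(s, Q) = 1`) has symbol `+1` IDENTICALLY.
Such "forced" pairs are abundant exactly where `Q' − Q` is small (balanced pairs, the θ → 1 corner) and their mass in
the crux population is ≍ x^{1−θ/2}/log²x — the same order as, and opposite in sign to, the Chebyshev term of the
unbalanced pairs (§H); crux-triage r1-2 (gen 2) measured both region by region at 10⁵…10⁷. -/

/-- FORCED PAIRS: `(Q + 4s² | Q) = +1` for odd `Q` coprime to `s` — the symbol of a pair whose difference is four times a
square is identically `+1`. -/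
theorem jacobiSym_add_four_mul_sq {Q s : ℕ} (hQ : Odd Q) (hs : Nat.Coprime s Q) :
    jacobiSym ((Q : ℤ) + 4 * (s : ℤ) ^ 2) Q = 1 := by
  have hmod : ((Q : ℤ) + 4 * (s : ℤ) ^ 2) % (Q : ℤ) = ((2 * (s : ℤ)) ^ 2) % (Q : ℤ) := by
    have e : (Q : ℤ) + 4 * (s : ℤ) ^ 2 = (2 * (s : ℤ)) ^ 2 + (Q : ℤ) * 1 := by ring
    rw [e, Int.add_mul_emod_self_left]
  rw [jacobiSym.mod_left' hmod]
  apply jacobiSym.sq_one'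
  -- gcd(2s, Q) = 1
  have h2 : Nat.Coprime 2 Q := (Nat.coprime_two_left).mpr hQ
  have h : Nat.Coprime (2 * s) Q := Nat.Coprime.mul_left h2 hs
  rw [show (2 * (s : ℤ)) = ((2 * s : ℕ) : ℤ) by push_cast; ring, Int.gcd_natCast_natCast]
  exact h.gcd_eq_one

/-- … hence on the crux's pairs: if `Q' = Q + 4s²` with `gcd(s,Q) = 1` (and `x ≥ 4`, `θ > 1/2`, so both are odd primes
`≡ 1 (mod 4)`), the summand is `+1`. -/
theorem jacobiSym_eq_one_of_sq_diff {θ : ℝ} {x t : ℕ} {q : ℕ × ℕ} (hx : 4 ≤ x) (hθ : 1 / 2 < θ)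
    (hq : q ∈ pairs θ x t) {s : ℕ} (hs : Nat.Coprime s q.1) (hdiff : q.2 = q.1 + 4 * s ^ 2) :
    jacobiSym (q.1 : ℤ) q.2 = 1 := by
  rw [jacobiSym_symm_of_mem_pairs hx hθ hq, hdiff]
  have hodd : Odd q.1 := Nat.odd_iff.mpr (by have := (mod_four_of_mem_pairs hx hθ hq).1; omega)
  have := jacobiSym_add_four_mul_sq hodd hs
  push_cast at this ⊢
  exact this

/-! ### §D″ The descent parametrisation by `k = (A+B)/2 − t` (all families at once; prose + two identities)

Every factorisation `t²+1 = A·B` (A < B) has a DESCENT partner: `(t − A)² + 1 = A·(A + B − 2t)` (`descent_identity`), i.e.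
with `u = t − A`, `2k = A + B − 2t`: `A = (u²+1)/(2k)`, `B = ((u+2k)²+1)/(2k)`, `t = u + A` — the factorisations with
parameter `k` form the family `F_k = {u ≡ ν (mod 2k), ν² ≡ −1}` (`F_1` = the Aurifeuillian family of §D, `t = 2m²`).
Along `F_k` the symbol is `(B|A) = (B − A | A) = (2w | A)`, `w = u + k = (B−A)/2` (`jacobiSym_eq_of_sub`), and by
reciprocity `= (2|A)^{1+v₂(w)}·(2k(k²+1) | w_odd)` (verified on all 2562 coprime factorisations with even `t ≤ 3000`,
0 failures): PERIODIC in `u`, with a non-principal character unless `2k(k²+1)` is a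
square, i.e. unless `k = 1` (`2(a⁴+1) = b²`-type equation) — so F_1 is the only identically-coherent family, the forced
pairs of §D′ are the `w = 2s²`-slice across families, and a family has ≍ √(x/k) members below `x`: many members ⟺ small
`k` ⟺ BALANCED pairs (`k ≈ (√B − √A)²/2`), while the crux's unbalanced pairs have `2k ≈ Q'` and at most one member
(the small-root regime again, now as "at most one element of the root class of 2k below √(2kx)"). -/

/-- The classical descent step: `A ∣ t²+1` with cofactor `B` gives `A ∣ (t−A)²+1` with cofactor `A + B − 2t`. -/
theorem descent_identity {t A B : ℤ} (h : t ^ 2 + 1 = A * B) : (t - A) ^ 2 + 1 = A * (A + B - 2 * t) := by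
  linear_combination h

/-- `(B | A) = (B − A | A)`: along a descent family the symbol only sees the difference `B − A = 2w`. -/
theorem jacobiSym_eq_of_sub (A : ℕ) (B : ℤ) : jacobiSym B A = jacobiSym (B - A) A :=
  jacobiSym.mod_left' (by rw [Int.sub_emod, Int.emod_self, sub_zero, Int.emod_emod_of_dvd _ (dvd_refl _)])

/-! ## §F Structure: the symbol is a SPIN on `SL₂(ℤ)` (why no summation variable survives)

Coprime factorisations `t² + 1 = A · B` are parametrised by `γ = (a b; c d) ∈ SL₂(ℤ)` through
`A = a² + b²`, `B = c² + d²`, `t = ac + bd` (Lagrange's identity; conversely every coprime factorisation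
arises this way since `ℤ[i]` is a UFD — not formalised here). In these coordinates the Jacobi symbol is the
"spin" `(A | B) = (1 + 2bc | B)` (`jacobiSym_rows_eq_spin`), and moving along the horocycle `γ ↦ T^k γ`
(`(a,b) ↦ (a + kc, b + kd)`, which fixes `B` and shifts `t` by `kB`) changes it to `(1 + 2bc + 2kcd | B)`
(`jacobiSym_rows_horocycle`): an arithmetic progression of modulus-`B` residues, i.e. the symbol
EQUIDISTRIBUTES along each horocycle with period `B` — this is the Burgess/complete-sum input of
SingleBlockMoments for `B ≤ x^{1−ε}` — while for `B > x` each horocycle meets `t ≤ x` at most ONCE, so no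
averaging variable is left: the crux in the split-block range is a sum of a non-automorphic spin over
hyperbolic lattice points, one per horocycle (cf. Friedlander–Iwaniec–Mazur–Rubin spin sums). The spin is not
a congruence character: on `γ_M = (1 M; M M²+1) ∈ Γ(M)` it takes the values −1, +1, −1, +1 for M = 1..4
(`spin_gammaM_values`). -/

/-- Lagrange's identity in the form used here. -/
theorem lagrange_identity (a b c d : ℤ) :
    (a * c + b * d) ^ 2 + (a * d - b * c) ^ 2 = (a ^ 2 + b ^ 2) * (c ^ 2 + d ^ 2) := by ring

/-- Every `γ ∈ SL₂(ℤ)` yields a factorisation `t² + 1 = (a²+b²)(c²+d²)` with `t = ac + bd`. -/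
theorem sq_add_one_eq_mul_of_det {a b c d : ℤ} (h : a * d - b * c = 1) :
    (a * c + b * d) ^ 2 + 1 = (a ^ 2 + b ^ 2) * (c ^ 2 + d ^ 2) := by
  rw [← lagrange_identity, h]; ring

/-- SPIN FORM of the symbol: for `γ = (a b; c d) ∈ SL₂(ℤ)` and `B = c² + d²`,
`(a² + b² | B) = (1 + 2bc | B)`. Proof: `d²(a²+b²) ≡ (ad − bc)(ad + bc) = 1 + 2bc (mod B)` and `(d|B)² = 1`. -/
theorem jacobiSym_rows_eq_spin {a b c d : ℤ} {B : ℕ} (h : a * d - b * c = 1) (hB : (B : ℤ) = c ^ 2 + d ^ 2) :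
    jacobiSym (a ^ 2 + b ^ 2) B = jacobiSym (1 + 2 * b * c) B := by
  -- gcd(d, B) = 1
  have hcd : IsCoprime d c := ⟨a, -b, by linear_combination h⟩
  have hdB : IsCoprime d (B : ℤ) := by
    rw [hB, show c ^ 2 + d ^ 2 = c ^ 2 + d * d by ring]
    exact (IsCoprime.pow_right (n := 2) hcd).add_mul_left_right d
  have hgcd : Int.gcd d (B : ℤ) = 1 := Int.isCoprime_iff_gcd_eq_one.mp hdB
  have hsq : jacobiSym (d ^ 2) B = 1 := jacobiSym.sq_one' hgcd
  have hmod : (d ^ 2 * (a ^ 2 + b ^ 2)) % (B : ℤ) = (1 + 2 * b * c) % (B : ℤ) := by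
    have e : d ^ 2 * (a ^ 2 + b ^ 2) = (1 + 2 * b * c) + (B : ℤ) * b ^ 2 := by
      rw [hB]
      have h1 : a * d = 1 + b * c := by linear_combination h
      linear_combination (a * d + 1 + b * c) * h1
    rw [e, Int.add_mul_emod_self_left]
  calc jacobiSym (a ^ 2 + b ^ 2) B
      = jacobiSym (d ^ 2) B * jacobiSym (a ^ 2 + b ^ 2) B := by rw [hsq, one_mul]
    _ = jacobiSym (d ^ 2 * (a ^ 2 + b ^ 2)) B := (jacobiSym.mul_left _ _ _).symm
    _ = jacobiSym (1 + 2 * b * c) B := jacobiSym.mod_left' hmod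

/-- HOROCYCLE PERIODICITY: replacing `(a, b)` by `(a + kc, b + kd)` (same `B`, `t ↦ t + kB`) turns the spin
into `(1 + 2bc + 2kcd | B)`, an arithmetic progression in `k` of difference `2cd` coprime to `B`: along a
horocycle the symbol runs through a complete residue system mod `B` with period `B`. -/
theorem jacobiSym_rows_horocycle {a b c d : ℤ} {B : ℕ} (h : a * d - b * c = 1)
    (hB : (B : ℤ) = c ^ 2 + d ^ 2) (k : ℤ) :
    jacobiSym ((a + k * c) ^ 2 + (b + k * d) ^ 2) B = jacobiSym (1 + 2 * b * c + 2 * k * c * d) B := by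
  have h' : (a + k * c) * d - (b + k * d) * c = 1 := by linear_combination h
  rw [jacobiSym_rows_eq_spin h' hB]
  ring_nf

/-- The spin is not a congruence character: `γ_M = (1 M; M M²+1) ∈ Γ(M)` has spin
`(1 + 2M² | M⁴ + 3M² + 1)` = −1, +1, −1, +1 for `M = 1, 2, 3, 4`. -/
theorem spin_gammaM_values :
    jacobiSym (1 + 2 * 1 ^ 2) (1 ^ 4 + 3 * 1 ^ 2 + 1) = -1 ∧
    jacobiSym (1 + 2 * 2 ^ 2) (2 ^ 4 + 3 * 2 ^ 2 + 1) = 1 ∧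
    jacobiSym (1 + 2 * 3 ^ 2) (3 ^ 4 + 3 * 3 ^ 2 + 1) = -1 ∧
    jacobiSym (1 + 2 * 4 ^ 2) (4 ^ 4 + 3 * 4 ^ 2 + 1) = 1 := by
  norm_num

/-! ## §G Function-field model (numerics + two exact identities; prose only)

Over `𝔽_q[u]`, `q ≡ 3 (mod 4)` (so `i ∉ 𝔽_q` and `𝔽_{q²}[u]` plays `ℤ[i]`): `t` monic of degree `n`, `f = t² + 1 =
N(t + i)`; every irreducible factor of `f` has EVEN degree, and `(Q|Q') = Q^{(q^{deg Q'}−1)/2} mod Q' =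
Legendre(Res(Q', Q) | q)` is SYMMETRIC — a faithful analogue of the crux's symbol; `x = q^n`, `Q > x^θ ↔ deg Q > θn`.
The crux corresponds to `q` FIXED, `n → ∞`.
* EXACT IDENTITY (n = 2, this seat): the only pattern is `f = Q₂Q₂'` (t + i splits over 𝔽_{q²}); the symbol equals
  `χ₄(disc(t + i)) = χ₄(c − 4i)`, `c = a² − 4b ∈ 𝔽_q`, and `Σ_{c ∈ 𝔽_q} χ₄(c − 4i) = −1` because `χ₄` is trivial on
  `𝔽_q^×` (`4 ∣ q + 1`), so the sum runs over `ℙ¹(𝔽_q)` minus the real point. Hence `S = −q`, `N = q(q−1)/2`: a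
  relative bias `−2/(q−1)` (for q = 3 EVERY symbol is −1). Checked q = 3, 7, 11, 19, 23.
* EXACT IDENTITY (n = 3): `Σ_{(t,ρ) : t(ρ) = −i, ρ ∈ 𝔽_{q²}} χ₂(t'(ρ)) = −(q² − q)` (each ρ contributes a χ₂-sum over a
  shifted 𝔽_q-line = −1), and `(Q₂ | Q₄) = χ₂(t'(ρ))` on the pattern (2,4); measured split: q = 7: (2,4) gives
  −126/210 (z = −8.7), q = 19: −1026/3078 (z = −18.5), q = 23: +184/6072 — sign follows (3|q).
* NUMERICS (kit j005729, flint-factored, file ff_tables.md on the item; q = 3 to n = 14, q = 7 to n = 8, q = 11 to 6,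
  q = 19 to 5, q = 23 to 4). Aggregate S/N at θ = 0.51: q = 3, n = 6…14: −0.120, −0.017, −0.026, +0.021, −0.0093, +0.0030,
  −0.0057, −0.0024, −0.0029 (N = 2.2·10⁶ at n = 14, z = −4.4); q = 7, n = 3…8: −0.571, −0.130, −0.0068, +0.0275, −0.0041,
  +0.0033 (z = +4.0); q = 11, n = 3…6: −0.083, +0.028, +0.049 (z = +10.7), +0.0037; q = 19, n = 3, 4, 5: −0.140, +0.030, −0.0171
  (z = −14.7); q = 23, n = 3, 4: −0.006, +0.052 (z = +9.9). EMPIRICAL SCALING LAW: |S/N| ≈ c·q^{−(n−2)/2} (q = 7: 0.13, 0.027,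
  0.0033 at n = 4, 6, 8 vs 7^{−1,−2,−3} = 0.14, 0.020, 0.0029; q = 3: 0.12, 0.026, 0.009, 0.0057, 0.0029 at n = 6…14 even vs
  3^{−2…−6} = 0.11, 0.037, 0.012, 0.004, 0.0014), i.e. `S = O_q(√(q^n))` with a q-dependent constant (|S|/√N up to ≈ 15 at
  q = 19) and signs alternating in n: SQUARE-ROOT CANCELLATION, structured (not random-sign) — the exact analogue of the
  integer picture |J| ≲ 2.7√N with a persistent sign, and S/N → 0 like q^{−n/2} as the crux's analogue demands.
READING: the FF analogue shows (i) exact low-n identities from complete character sums over punctured projective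
lines (mechanism: constants 𝔽_q^× are squares/fourth powers in 𝔽_{q²} — NO integer analogue, rational integers are
not squares mod p), (ii) structured lower-order biases per factorisation pattern — the analogue of the sign-coherent
algebraic families of §D — and (iii) an aggregate relative bias decaying in n. It neither refutes nor supports a
bias for the integer crux beyond "lower-order structure exists"; a proof over ℤ valid verbatim over 𝔽_q[u] would have
to be compatible with the pattern-level biases (they are not o(N_pattern) uniformly in the pattern at fixed q). -/

/-! ## §H Second-order structure (numerical, heuristic — a WARNING for provers; file secondorder.md on the item)

Write `J_θ(x) = Σ_{x^θ<Q<Q'} (Q|Q')·c_x(QQ')` (modulus-side form, `J_eq_sum_pairs_mul_card`) and split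
`c_x(n) = 4x/n + (c_x(n) − 4x/n)`. Two measured facts pull in OPPOSITE directions:
* GENERIC prime pairs carry Chebyshev's bias: for Q ~ x^{0.6} (x = 10⁶) the tails `Σ_{Q<p≤10⁷, p≡1(4)} (p|Q)/p`
  average −0.0012 (se 0.0004; naive prediction from θ(y;χ_Q) ≈ −√y: −0.0015), and over the box Q ∈ (4000,6000),
  Q' ∈ (6000, 4·10⁵] the mean of (Q|Q') is −0.0036 (1.9·10⁶ pairs). So the NAIVE MAIN TERM `4x·Σ (Q|Q')/(QQ')` is
  NEGATIVE, of size ≍ x^{1−θ/2}/(θ log x)² (≈ −600 at (10⁶, 0.6), ≈ −3400 at (10⁷, 0.6)) — larger than √N_θ.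
* CRUX EVENTS do not see it: measured J_{0.6} = +707 (10⁶), +1067 (3·10⁶), +1455 (10⁷); the small-cofactor classes
  m = (t²+1)/(QQ') ∈ {1,2,5,10} have mean symbol +0.0027 at 10⁷ (z = +2.7; +0.011 at 1.25·10⁶, decaying roughly like
  x^{−1/2…−2/3}), larger m slightly negative; no class, block or root-position bin has |z| > 2.7; 20–30 t-blocks have
  variance ≈ 1 and mean z = +0.27 ± 0.2. The mean symbol versus the position u = ν/(QQ') of the roots is FLAT for
  generic pairs (fifty 0.01-bins within ±2σ of −0.0036) except possibly at u < 10⁻³ (+0.030 ± 0.008, i.e. exactly the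
  small-root = crux events).
READING, REFINED by crux-triage r1-2 (gen 2, regions.py/corner_bias.py at 10⁵…10⁷): BOTH secular terms live in the
h = 0 ("expected") part E = 4x·Σ (Q|Q')/(QQ') of the pair-side Poisson split J = E + D and both are visible inside the
crux population region by region — the Chebyshev term of UNBALANCED pairs (J over {QQ' ≤ x^{1.49}, Q > x^{0.505}} =
−259, −863, −4514 at 10⁵, 10⁶, 10⁷, z to −3.9, |J| ≍ x^{0.72}) and the POSITIVE forced term of BALANCED pairs (§D′:
Q' − Q = 4s² ⇒ symbol +1 identically; mass ≍ x^{(3+δ−3θ)/2}/log²x in the corner QQ' ≤ x^{1+δ}), while the root-count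
weights c_x(QQ') are UNCORRELATED with the symbol (mean c given symbol ±1 equal within 1σ; D_corner = J − E ≈ 0). So:
`E` is NOT small pointwise in sub-regions (any regional experiment must subtract E, not √N), but E = o(x) globally is a
theorem-grade statement (Heath-Brown's real-character large sieve), and the crux is exactly D = o(x). None of this
threatens `o(x)`: every measured offset is O(x^{1−θ/2}/log²x) = o(x), max |J|/N over every region and scale is 0.011 and
decreasing in x per region. My earlier "no prime squares among (t²+1)/(Qm)" reading of the sign is superseded. -/

/-! ## §E Near-misses and refuted strengthenings (work items; `sorry` allowed ONLY here) -/

/-- NEAR-MISS (numerical refutation of the θ-extension; NOT formalisable cheaply).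
Dropping `1/2 < θ` entirely makes the statement FALSE at `θ = 0`: for `x ≥ 2` every pair of
distinct prime factors of `t²+1` is counted and
`J_0(x) = Σ_{Q<Q'} (Q|Q')·#{t ≤ x : QQ' ∣ t²+1} = c₀·x + o(x)` heuristically, with
`c₀ = Σ_{Q<Q'} (Q|Q') ρ(Q)ρ(Q')/(QQ')` (ρ(2) = 1, ρ(p) = 2 for p ≡ 1 (4)), whose first terms
(2|5)·2/10 = −0.2, (2|13)·2/26, (5|13)·4/65, (5|17)·4/85, … are all negative; partial sums −0.369 (10²),
−0.418 (10³), −0.427 (10⁴), −0.4300 (10⁵), −0.4305 (3·10⁵, kit j004900); MEASURED `J_0(x)/x = −0.4290` at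
`x = 10⁶` (stable to 3 digits from 2.5·10⁴ on;
local pure-python run theta0_local.py, tables on the item; kit j004903 repeats at 10⁷). So `c₀ ≈ −0.429 ≠ 0`.
Obstruction to a Lean proof: an effective lower bound |J_0(x)| ≥ c·x needs the convergence of the
pair series with an explicit tail bound (bilinear Jacobi sums over primes + Brun–Titchmarsh for
ρ-weighted counts) — theorem-grade analytic number theory, out of scope for this file. -/
theorem not_SplitBlockJacobiWithoutLower : ¬ SplitBlockJacobiWithoutLower := by
  sorry

end Summit.Parity.BatemanHorn.Cruxes.SplitBlockJacobi.Disproof
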